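import Literature.NumberTheory.GaloisRepresentations.InertiaRootsOfUnity
import Literature.NumberTheory.GaloisRepresentations.AbsGaloisGroup
import Literature.NumberTheory.GaloisRepresentations.PadicAlgebraOfLocalField
import Literature.NumberTheory.PAdicHodge.PadicBaseField
import Mathlib.Analysis.AbsoluteValue.Equivalence
import Mathlib.Analysis.Normed.Unbundled.SpectralNorm
import Mathlib.Analysis.SpecificLimits.Normed
import HarnessLib

/-!
# Absolute values along a continuous embedding of `p`-adic fields

Let `K → L` (`algebraMap K L`) be a *continuous* embedding of non-archimedean local fields of
characteristic `0` and residue characteristic `ℓ` (`|ℓ|_K < 1`, `|ℓ|_L < 1`), and let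
`ι = absClosureEmbedding K L : K̄ →ₐ[K] L̄` be the tree's chosen `K`-embedding of algebraic closures
(`GaloisRepresentations/AbsGaloisGroup.lean`).  Write `‖·‖_K`, `‖·‖_L` for the valuation norms
`IsNonarchimedeanLocalField.nontriviallyNormedField K`, `… L` and `‖·‖_{K̄} = algNorm K`,
`‖·‖_{L̄} = algNorm L` for their spectral extensions to the algebraic closures
(`GaloisRepresentations/InertiaRootsOfUnity.lean`).  We prove:

* `exists_norm_algebraMap_eq_rpow` — **base level**: `‖x‖_L = ‖x‖_K ^ c` on `K` for some real
  `c > 0`.  The norm of `K` and the pull-back of the norm of `L` are absolute values of `K`, the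
  first nontrivial (`‖ℓ‖_K < 1`), with `‖x‖_K < 1 → ‖x‖_L < 1` (`xⁿ → 0` in `K`, hence in `L` by
  continuity); so they are equivalent, hence powers of one another (Mathlib
  `AbsoluteValue.isEquiv_of_lt_one_imp`, `AbsoluteValue.isEquiv_iff_exists_rpow_eq`).
* `exists_algNorm_absClosureEmbedding_eq_rpow` — **the closures**: `‖ι x‖_{L̄} = ‖x‖_{K̄} ^ c`
  for all `x ∈ K̄`, with the same `c`.  The function `x ↦ ‖ι x‖_{L̄} ^ (1/c)` is an absolute value
  of `K̄` (ultrametricity of `‖·‖_{L̄}`) extending `‖·‖_K`, so it is the spectral norm, by the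
  uniqueness of the extension of the absolute value of a complete field to an algebraic extension
  (Mathlib `spectralNorm_unique_field_norm_ext`).
* `algebra_isAlgebraic_of_continuous_algebraMap` — **`L/K` is algebraic**: `L` is finite over
  the copy `K₀ = PadicBase L ℓ hL` of `ℚ_ℓ` (`PAdicHodge/PadicBaseField.lean`), and
  `K₀ → K → L` is a scalar tower because the continuous embedding `ℚ_ℓ → L` is unique
  (`LocalField.eq_padicRingHom_of_continuous`, file
  `GaloisRepresentations/PadicAlgebraOfLocalField.lean`).

These are the two inputs of the transport of Fontaine's period rings along `K̄ ≅ L̄` used for the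
base change of de Rham representations (Brinon–Conrad, *CMI notes*, Prop. 6.3.8).

Sources: J. Neukirch, *Algebraic Number Theory* (1999), Ch. II, Prop. (3.3) (equivalent absolute
values are powers of one another), Thm. (4.8) (uniqueness of the extension of the absolute value
of a complete field to an algebraic extension) and Prop. (5.2) (local fields of characteristic `0`
are finite over `ℚ_p`); J.-P. Serre, *Local Fields* (1979), Ch. II §2 (finite extensions of
complete fields) and §5 (`p`-adic fields over `ℚ_p`).

NOT here: the value of `c` (the normalisations of `‖·‖_K`, `‖·‖_L` are Mathlib's choices of
rank-one structures, so `c` is not determined); the bijectivity of `ι` (tree: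
`absClosureEmbedding_bijective`, which consumes the algebraicity proved here); anything about the
completions `ℂ_K`, `ℂ_L` or the period rings.
-/

open Field ValuativeRel Filter
open scoped Topology

namespace Literature.NumberTheory.PAdicHodge

open Literature.NumberTheory.GaloisRepresentations
open Literature.NumberTheory.GaloisRepresentations.IsNonarchimedeanLocalField

variable {K L : Type} [Field K] [ValuativeRel K] [TopologicalSpace K] [IsNonarchimedeanLocalField K]
  [CharZero K] [Field L] [ValuativeRel L] [TopologicalSpace L] [IsNonarchimedeanLocalField L]
  [CharZero L] [Algebra K L] {ℓ : ℕ} [Fact ℓ.Prime]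

omit [CharZero L] in
/-- **Base level: the norm of `L` restricts to a power of the norm of `K`.**  For a continuous
embedding `K → L` of local fields (`K` of characteristic `0` and residue characteristic `ℓ`) there
is a real `c > 0` with `‖algebraMap K L x‖_L = ‖x‖_K ^ c` for all `x ∈ K`: the valuation norm of
`K` and the pull-back of the valuation norm of `L` are equivalent absolute values of `K`
(`‖x‖_K < 1 ⇒ xⁿ → 0 ⇒ (algebraMap K L x)ⁿ → 0 ⇒ ‖algebraMap K L x‖_L < 1`), and equivalent real
absolute values are positive powers of one another.  Ref: Neukirch, *ANT*, Ch. II, Prop. (3.3) and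
its proof (`|x|₁ < 1 ⇒ |x|₂ < 1` already forces equivalence).
[cite: NeukirchANT1999, Ch. II (3.3)] -/
theorem exists_norm_algebraMap_eq_rpow (hcont : Continuous (algebraMap K L))
    (hK : valuation K (ℓ : K) < 1) :
    ∃ c : ℝ, 0 < c ∧ ∀ x : K,
      (letI := nontriviallyNormedField L; ‖algebraMap K L x‖) =
        (letI := nontriviallyNormedField K; ‖x‖) ^ c := by
  letI := nontriviallyNormedField K
  letI := nontriviallyNormedField L
  -- `‖x‖_K < 1 → ‖x‖_L < 1`: `xⁿ → 0` in `K`, hence in `L` by continuity of `algebraMap K L`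
  have hlt : ∀ x : K, ‖x‖ < 1 → ‖algebraMap K L x‖ < 1 := by
    intro x hx
    have h0 : Tendsto (fun n : ℕ => algebraMap K L (x ^ n)) atTop (𝓝 (algebraMap K L 0)) :=
      (hcont.tendsto 0).comp (tendsto_pow_atTop_nhds_zero_of_norm_lt_one hx)
    simp only [map_pow, map_zero] at h0
    exact tendsto_pow_atTop_nhds_zero_iff_norm_lt_one.1 h0
  -- the norm of `K` is a nontrivial absolute value: `0 < ‖ℓ‖_K < 1`
  have hv : (NormedField.toAbsoluteValue K).IsNontrivial :=
    ⟨ℓ, Nat.cast_ne_zero.2 (Fact.out : ℓ.Prime).ne_zero, ((norm_lt_one_iff K _).2 hK).ne⟩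
  obtain ⟨c, hc, hcw⟩ := AbsoluteValue.isEquiv_iff_exists_rpow_eq.1
    (AbsoluteValue.isEquiv_of_lt_one_imp
      (w := (NormedField.toAbsoluteValue L).comp (algebraMap K L).injective) hv hlt)
  exact ⟨c, hc, fun x => (congrFun hcw x).symm⟩

omit [CharZero L] in
/-- **The chosen embedding `ι = absClosureEmbedding K L : K̄ → L̄` is a homothety in the
exponent for the absolute values of the algebraic closures**: for a continuous embedding `K → L`
of local fields of characteristic `0` and residue characteristic `ℓ` there is a real `c > 0` with
`‖ι x‖_{L̄} = ‖x‖_{K̄} ^ c` for all `x ∈ K̄` (`‖·‖_{F̄} = algNorm F`).  Proof: with `c` from the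
base level (`exists_norm_algebraMap_eq_rpow`), `x ↦ ‖ι x‖_{L̄} ^ (1/c)` is an absolute value of `K̄`
extending `‖·‖_K`, hence it is the spectral norm `algNorm K` by the uniqueness of the extension of
the absolute value of the complete field `K` to its algebraic extension `K̄`.  The hypothesis
`|ℓ|_L < 1` is not used (it is part of the common interface of this file).
Ref: Neukirch, *ANT*, Ch. II, Thm. (4.8); Serre, *Local Fields*, Ch. II §2.
[cite: NeukirchANT1999, Ch. II (4.8)] -/
theorem exists_algNorm_absClosureEmbedding_eq_rpow (hcont : Continuous (algebraMap K L))
    (hK : valuation K (ℓ : K) < 1) (_hL : valuation L (ℓ : L) < 1) :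
    ∃ c : ℝ, 0 < c ∧ ∀ x : AlgebraicClosure K,
      algNorm L (absClosureEmbedding K L x) = algNorm K x ^ c := by
  obtain ⟨c, hc, hcK⟩ := exists_norm_algebraMap_eq_rpow (L := L) hcont hK
  refine ⟨c, hc, fun x => ?_⟩
  letI := nontriviallyNormedField K
  -- the absolute value `y ↦ ‖ι y‖_{L̄} ^ (1/c)` of `K̄`
  obtain ⟨f, hf⟩ : ∃ f : AbsoluteValue (AlgebraicClosure K) ℝ,
      ∀ y, f y = algNorm L (absClosureEmbedding K L y) ^ c⁻¹ :=
    ⟨{ toFun := fun y => algNorm L (absClosureEmbedding K L y) ^ c⁻¹,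
        map_mul' := fun y z => by
          simp only [map_mul, algNorm_mul]
          exact Real.mul_rpow (algNorm_nonneg _) (algNorm_nonneg _),
        nonneg' := fun y => Real.rpow_nonneg (algNorm_nonneg _) _,
        eq_zero' := fun y => by
          show algNorm L (absClosureEmbedding K L y) ^ c⁻¹ = 0 ↔ y = 0
          rw [Real.rpow_eq_zero_iff_of_nonneg (algNorm_nonneg _), algNorm_eq_zero_iff, map_eq_zero]
          exact and_iff_left (inv_ne_zero hc.ne'),
        add_le' := fun y z => by
          show algNorm L (absClosureEmbedding K L (y + z)) ^ c⁻¹ ≤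
            algNorm L (absClosureEmbedding K L y) ^ c⁻¹ +
              algNorm L (absClosureEmbedding K L z) ^ c⁻¹
          rw [map_add]
          rcases le_total (algNorm L (absClosureEmbedding K L y))
              (algNorm L (absClosureEmbedding K L z)) with h | h
          · exact (Real.rpow_le_rpow (algNorm_nonneg _)
                ((algNorm_add_le _ _).trans (max_le h le_rfl)) (inv_nonneg.2 hc.le)).trans
              (le_add_of_nonneg_left (Real.rpow_nonneg (algNorm_nonneg _) _))
          · exact (Real.rpow_le_rpow (algNorm_nonneg _)
                ((algNorm_add_le _ _).trans (max_le le_rfl h)) (inv_nonneg.2 hc.le)).trans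
              (le_add_of_nonneg_right (Real.rpow_nonneg (algNorm_nonneg _) _)) },
      fun _ => rfl⟩
  -- `f` extends `‖·‖_K`: `ι` is `K`-linear and `‖·‖_{L̄}` extends `‖·‖_L = ‖·‖_K ^ c` on `K`
  have hf_ext : ∀ k : K, f (algebraMap K (AlgebraicClosure K) k) = ‖k‖ := by
    intro k
    rw [hf, (absClosureEmbedding K L).commutes k,
      IsScalarTower.algebraMap_apply K L (AlgebraicClosure L) k, algNorm_algebraMap, hcK k,
      Real.rpow_rpow_inv (norm_nonneg _) hc.ne']
  -- uniqueness of the extension of `‖·‖_K` to `K̄`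
  have hfx : f x = algNorm K x := by
    rw [algNorm_def]
    exact spectralNorm_unique_field_norm_ext hf_ext x
  rw [hf] at hfx
  rw [← hfx, Real.rpow_inv_rpow (algNorm_nonneg _) hc.ne']

/-- **`L/K` is algebraic** for a continuous embedding `K → L` of local fields of characteristic
`0` and residue characteristic `ℓ`.  Both fields contain a canonical copy of `ℚ_ℓ`
(`LocalField.padicRingHom`), `L` is finite — hence algebraic — over its copy
`K₀ = PadicBase L ℓ hL` (a locally compact normed space over a complete field is
finite-dimensional), and `K₀ → K → L` is a scalar tower because a continuous ring homomorphism
`ℚ_ℓ → L` is unique (`LocalField.eq_padicRingHom_of_continuous`); so `L` is algebraic over the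
intermediate field `K`.  Ref: Neukirch, *ANT*, Ch. II, Prop. (5.2) (local fields of
characteristic `0` are the finite extensions of `ℚ_p`); Serre, *Local Fields*, Ch. II §5.
[cite: NeukirchANT1999, Ch. II (5.2)] -/
theorem algebra_isAlgebraic_of_continuous_algebraMap (hcont : Continuous (algebraMap K L))
    (hK : valuation K (ℓ : K) < 1) (hL : valuation L (ℓ : L) < 1) :
    Algebra.IsAlgebraic K L := by
  -- the continuous embedding `ℚ_ℓ → L` is unique, so `ℚ_ℓ → K → L` is the canonical one
  have huniq : (algebraMap K L).comp (LocalField.padicRingHom K ℓ hK) =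
      LocalField.padicRingHom L ℓ hL :=
    LocalField.eq_padicRingHom_of_continuous L ℓ hL _
      (hcont.comp (LocalField.continuous_padicRingHom K ℓ hK))
  -- `K` as an algebra over the base field `K₀ = ℚ_ℓ` of `L`
  letI : Algebra (PadicBase L ℓ hL) K :=
    ((LocalField.padicRingHom K ℓ hK).comp (PadicBase.toPadic hL).toRingHom).toAlgebra
  haveI : IsScalarTower (PadicBase L ℓ hL) K L :=
    IsScalarTower.of_algebraMap_eq fun x => by
      show PadicBase.emb hL x =
        algebraMap K L (LocalField.padicRingHom K ℓ hK (PadicBase.toPadic hL x))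
      rw [PadicBase.emb_apply, ← huniq]
      rfl
  exact Algebra.IsAlgebraic.tower_top (K := PadicBase L ℓ hL) K

end Literature.NumberTheory.PAdicHodge
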